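import Mathlib
import Literature.MathematicalPhysics.QuantumFieldTheory.Balaban1983to89.B8Eq194CriterionCurved

/-!
# G-B8-19 (c): a TWO-BLOCK DEFECT theorem on the (3.25)-lattice carriers — one non-trivial bond variable between two
# blocks breaks the criterion Q′ΔN(Q′) = 0 behind «(1.91)'s H′ = [4]'s H′ (3.163)» (the abstract half of the
# (2,2)-torus witness `B8Eq194CriterionTorus22Defect`)

statement-level skeleton of published theorems with citation tags; proofs where landed; nothing here is a claim
about the Yang–Mills mass gap

Seat p40 gen 10, Phase 2 (free target; owner r05 row B8.Eq1.91; GAPS G-B8-19 (c) ADDENDUM 6 — precision: «for the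
(2,2)-TORUS only the flat half is kernel-checked (part 2/6: criterion holds) — its failure at a curved background is a
BY-HAND computation … NOT in the tree»).  Sources: [Balaban1985RegularSpaces] T. Bałaban, *Spaces of regular gauge
field configurations on a lattice and gauge fixing conditions*, CMP 99 (1985) 75–102: (1.91) p. 91 [PDF 17] «H′ =
G′²Q′\*(Q′G′²Q′\*)⁻¹»; [Balaban1985BackgroundPropagators] T. Bałaban, *Propagators for lattice gauge theories in a
background field*, CMP 99 (1985) 389–434: (3.3) p. 391 «(D^η_{U₀}A)(b) = η⁻¹(R(U₀(b))A(b₊) − A(b₋))», (3.19) p. 393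
«(Q′_j(U)λ)(y) = Σ_{x∈B^j(y)} L^{−jd} R(U(Γ^{(j)}_{y,x}))λ(x)», (3.23) p. 394 «Δ^η_U = D^{η\*}_U D^η_U», (3.24)–(3.25)
p. 394, (3.162)–(3.165) p. 429.

WHY THIS FILE.  §5 of `B8Eq194CriterionCurved` (p308212) showed that ONE block (K = 1) is background-dependent by a
single defect bond INSIDE the block.  The remaining by-hand item of GAPS G-B8-19 (c) — the torus with (L, K) = (2, 2),
where `not_criterion_of_adjacent_blocks` does not apply because every site of a cube is bonded to the neighbouring
cube — needs the two-block analogue: a defect bond BETWEEN two blocks.  This file proves it for an arbitrary bond set;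
`B8Eq194CriterionTorus22Defect` instantiates it on (ℤ/4)^d.

CONTENT.  **`not_criterion_twoBlock_defect`**: two blocks c ≠ c′; the background `defectT p q R` (transports 1 except
R on ONE bond ⟨p, q⟩ with p ∈ B(c′), q ∈ B(c)); a second bond ⟨x₁, x₂⟩ from x₁ ∈ B(c) to x₂ ∈ B(c′), x₂ ≠ p; every
other bond touching {p, x₂} has both ends off B(c); uniform weight κ ≠ 0 on B(c), equal weights at p, x₂ in c′, p and
x₂ in no third block; contours of c (and of c′ at p, x₂) avoiding ⟨p, q⟩.  Then λ := δ_{x₂}u − δ_p u ∈ N(Q′) and,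
through ⟨Δλ, 𝟙_{B(c)}v⟩ = ⟨Dλ, D(𝟙_{B(c)}v)⟩ ((3.23), `inner_lapL_apply`),
⟨(Q′Δλ)(c), v⟩ = κ·(c_{⟨p,q⟩}⟨u, Rv⟩ − c_{⟨x₁,x₂⟩}⟨u, v⟩) — so the criterion FAILS as soon as
c_{⟨p,q⟩}R ≠ c_{⟨x₁,x₂⟩}·1 (e.g. equal bond weights and R ≠ 1).

HONEST SCOPE.  One non-trivial bond variable; R any linear map (R(U(b)) ∈ O(𝔤) in print); bond weights ≥ 0 with the
two named ones compared through c_{⟨p,q⟩}R ≠ c_{⟨x₁,x₂⟩}·1; no bound, no row head changes; value = a reusable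
kernel witness pattern for the cell's located reading G-B8-19 (c), NOT summit progress.
-/

namespace Literature.MathematicalPhysics.QuantumFieldTheory.Balaban1983to89.B8Eq194CriterionTwoBlockDefect

open Finset
open Literature.MathematicalPhysics.QuantumFieldTheory.Balaban1983to89.B9Eq323Ker
  Literature.MathematicalPhysics.QuantumFieldTheory.Balaban1983to89.B9Thm311Lattice
  Literature.MathematicalPhysics.QuantumFieldTheory.Balaban1983to89.B9Eq325Proj
  Literature.MathematicalPhysics.QuantumFieldTheory.Balaban1983to89.B8Eq191Hprime
  Literature.MathematicalPhysics.QuantumFieldTheory.Balaban1983to89.B8Eq194FirstTerm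
  Literature.MathematicalPhysics.QuantumFieldTheory.Balaban1983to89.B8Eq194Criterion
  Literature.MathematicalPhysics.QuantumFieldTheory.Balaban1983to89.B8Eq194CriterionLattice
  Literature.MathematicalPhysics.QuantumFieldTheory.Balaban1983to89.B8Eq194CriterionCarriers
  Literature.MathematicalPhysics.QuantumFieldTheory.Balaban1983to89.B8Eq194CriterionCarriersWitness
  Literature.MathematicalPhysics.QuantumFieldTheory.Balaban1983to89.B8Eq194CriterionCurved
open scoped InnerProductSpace

/-! ## §1  Two blocks, one defect bond between them, one further bond between them: the criterion fails -/

section TwoBlock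

variable {X : Type*} {Y : Type*} {V : Type*} [NormedAddCommGroup V] [InnerProductSpace ℝ V]
variable [Fintype X] [DecidableEq X] [FiniteDimensional ℝ V]

/-- **Two-block defect theorem.**  Blocks c ≠ c′ of a block system on the (3.25)-lattice carriers; the background
`defectT p q R` (R(U(b)) = 1 on every bond except R(U(⟨p, q⟩)) = R) with p ∈ B(c′), q ∈ B(c); a second bond
⟨x₁, x₂⟩ ∈ bonds with x₁ ∈ B(c), x₂ ∈ B(c′), x₂ ≠ p; every OTHER bond touching p or x₂ has both ends outside B(c);
p, x₂ lie in no block but c′ and carry equal weights there; B(c) has the uniform weight κ ≠ 0; the contours of c, and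
those of c′ to p and to x₂, avoid ⟨p, q⟩.  Then λ := δ_{x₂}u − δ_p u ∈ N(Q′) ((3.19)) has
⟨(Q′Δλ)(c), v⟩ = κ (c_{⟨p,q⟩}⟨u, Rv⟩ − c_{⟨x₁,x₂⟩}⟨u, v⟩) ((3.23) through ⟨Δλ, 𝟙_{B(c)}v⟩ = ⟨Dλ, D 𝟙_{B(c)}v⟩), hence
the criterion Q′ΔN(Q′) = 0 behind «(1.91)'s H′ = [4]'s H′ (3.163)» FAILS whenever c_{⟨p,q⟩}R ≠ c_{⟨x₁,x₂⟩}·1.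
[cite: Balaban1985BackgroundPropagators, (3.3) p. 391, (3.19) p. 393, (3.23) p. 394, (3.162)–(3.165) p. 429;
Balaban1985RegularSpaces, (1.91) p. 91] -/
theorem not_criterion_twoBlock_defect {bonds : Finset (X × X)} (cb : X × X → ℝ) (hcb : ∀ b ∈ bonds, 0 ≤ cb b)
    {w : Y → X → ℝ} {B : Y → Finset X} (Γ : Y → X → List X) (y : Y → X) {c c' : Y} (hcc : c ≠ c') {κ : ℝ}
    (hκ : κ ≠ 0) {p q x₁ x₂ : X} (hp : p ∈ B c') (hx₂ : x₂ ∈ B c') (hq : q ∈ B c) (hx₁ : x₁ ∈ B c) (hpx : p ≠ x₂)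
    (honlyp : ∀ c'', p ∈ B c'' → c'' = c') (honly₂ : ∀ c'', x₂ ∈ B c'' → c'' = c')
    (hwc : ∀ x ∈ B c, w c x = κ) (hw' : w c' p = w c' x₂)
    (hpq : (p, q) ∈ bonds) (h12 : (x₁, x₂) ∈ bonds)
    (hfar : ∀ b ∈ bonds, b ≠ (p, q) → b ≠ (x₁, x₂) → (b.1 = p ∨ b.1 = x₂ ∨ b.2 = p ∨ b.2 = x₂) →
      b.1 ∉ B c ∧ b.2 ∉ B c)
    (havoid : ∀ x ∈ B c, List.IsChain (fun a b => ¬ (a = p ∧ b = q)) (y c :: Γ c x))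
    (havoidp : List.IsChain (fun a b => ¬ (a = p ∧ b = q)) (y c' :: Γ c' p))
    (havoid₂ : List.IsChain (fun a b => ¬ (a = p ∧ b = q)) (y c' :: Γ c' x₂))
    {R : V →ₗ[ℝ] V} (hR : cb (p, q) • R ≠ cb (x₁, x₂) • LinearMap.id) :
    ¬ ∀ f : PiLp 2 (fun _ : X => V), qL (defectT p q R) w B Γ y f = 0 →
        qL (defectT p q R) w B Γ y (lapL (defectT p q R) bonds cb f) = 0 := by
  intro hcrit
  -- the sites p, x₂ are off B(c); q, x₁ are not p, x₂
  have hpc : p ∉ B c := fun h => hcc (honlyp c h)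
  have hx₂c : x₂ ∉ B c := fun h => hcc (honly₂ c h)
  have hqp : q ≠ p := fun h => hpc (h ▸ hq)
  have hq₂ : q ≠ x₂ := fun h => hx₂c (h ▸ hq)
  have h1p : x₁ ≠ p := fun h => hpc (h ▸ hx₁)
  have h1₂ : x₁ ≠ x₂ := fun h => hx₂c (h ▸ hx₁)
  have hne : (p, q) ≠ (x₁, x₂) := fun h => h1p (Prod.mk.inj h).1.symm
  -- u, v with ⟨u, c_{pq}Rv − c_{12}v⟩ ≠ 0: v not in the kernel of c_{pq}R − c_{12}, u := its image
  obtain ⟨v, hv⟩ : ∃ v, cb (p, q) • R v - cb (x₁, x₂) • v ≠ 0 := by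
    by_contra hall
    refine hR (LinearMap.ext fun v => ?_)
    have h := not_not.mp (not_exists.mp hall v)
    rw [LinearMap.smul_apply, LinearMap.smul_apply, LinearMap.id_apply]
    exact sub_eq_zero.mp h
  set u : V := cb (p, q) • R v - cb (x₁, x₂) • v with hu
  set T := defectT (V := V) p q R with hT
  set f : PiLp 2 (fun _ : X => V) := single x₂ u - single p u with hf
  have hfx : ∀ x, f x = (if x = x₂ then u else 0) - (if x = p then u else 0) := fun x => by
    rw [hf, PiLp.sub_apply, single_apply, single_apply]
  have hfp : f p = -u := by rw [hfx, if_neg hpx, if_pos rfl, zero_sub]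
  have hf₂ : f x₂ = u := by rw [hfx, if_pos rfl, if_neg (Ne.symm hpx), sub_zero]
  have hfq : f q = 0 := by rw [hfx, if_neg hq₂, if_neg hqp, sub_zero]
  have hf₁ : f x₁ = 0 := by rw [hfx, if_neg h1₂, if_neg h1p, sub_zero]
  have hf0 : ∀ x, x ≠ x₂ → x ≠ p → f x = 0 := fun x ha hb => by rw [hfx, if_neg ha, if_neg hb, sub_zero]
  have hP : ∀ x ∈ B c, pathTr T (y c :: Γ c x) = LinearMap.id :=
    fun x hx => pathTr_defectT_of_avoid p q R _ (havoid x hx)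
  -- λ ∈ N(Q′)
  have hqf : qL T w B Γ y f = 0 := by
    ext c''
    rw [hf, map_sub, PiLp.sub_apply, qL_single, qL_single, PiLp.zero_apply]
    by_cases hc'' : c'' = c'
    · subst hc''
      rw [if_pos hx₂, if_pos hp, hT, pathTr_defectT_of_avoid p q R _ havoid₂, pathTr_defectT_of_avoid p q R _ havoidp,
        hw', sub_self]
    · rw [if_neg (fun h => hc'' (honly₂ _ h)), if_neg (fun h => hc'' (honlyp _ h)), sub_zero]
  -- ⟨Σ_{x∈B(c)} (Δλ)(x), v'⟩ = Σ_b c_b ⟨(Dλ)(b), (D 𝟙_{B(c)}v')(b)⟩ = c_{pq}⟨u, Rv'⟩ − c_{12}⟨u, v'⟩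
  have hsum : ∀ v' : V, ⟪∑ x ∈ B c, lapL T bonds cb f x, v'⟫_ℝ
      = cb (p, q) * ⟪u, R v'⟫_ℝ - cb (x₁, x₂) * ⟪u, v'⟫_ℝ := by
    intro v'
    rw [sum_inner, Finset.sum_congr rfl fun x _ => inner_lapL_apply T bonds cb hcb f x v', Finset.sum_comm]
    have e : ∀ b ∈ bonds, ∑ x ∈ B c, cb b * ⟪covD T (WithLp.ofLp f) b.1 b.2, covD T (Pi.single x v') b.1 b.2⟫_ℝ
        = cb b * ⟪covD T (WithLp.ofLp f) b.1 b.2,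
            T b.1 b.2 (if b.2 ∈ B c then v' else 0) - (if b.1 ∈ B c then v' else 0)⟫_ℝ := by
      intro b _
      rw [← Finset.mul_sum, ← inner_sum]
      congr 2
      simp only [covD_apply]
      rw [Finset.sum_sub_distrib, ← map_sum, Finset.sum_pi_single, Finset.sum_pi_single]
    rw [Finset.sum_congr rfl e, Finset.sum_eq_add_of_mem (p, q) (x₁, x₂) hpq h12 hne fun b hb hbne => ?_]
    · rw [hT, defectT_same, covD_apply, defectT_same, covD_apply,
        defectT_of_ne R (fun h : x₁ = p ∧ x₂ = q => h1p h.1), if_pos hq, if_neg hpc, if_neg hx₂c, if_pos hx₁,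
        LinearMap.id_apply, LinearMap.id_apply]
      show cb (p, q) * ⟪R (f q) - f p, R v' - 0⟫_ℝ + cb (x₁, x₂) * ⟪f x₂ - f x₁, 0 - v'⟫_ℝ = _
      simp only [hfq, hfp, hf₂, hf₁, map_zero, zero_sub, neg_neg, sub_zero, inner_neg_right, mul_neg]
      ring
    · -- every other bond contributes 0
      obtain ⟨b₁, b₂⟩ := b
      have hT12 : T b₁ b₂ = LinearMap.id := by
        rw [hT]
        exact defectT_of_ne R fun h => hbne.1 (Prod.ext h.1 h.2)
      dsimp only at hT12 ⊢
      rw [hT12, LinearMap.id_apply, covD_apply, hT12, LinearMap.id_apply]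
      by_cases htouch : b₁ = p ∨ b₁ = x₂ ∨ b₂ = p ∨ b₂ = x₂
      · obtain ⟨ho1, ho2⟩ := hfar (b₁, b₂) hb hbne.1 hbne.2 htouch
        dsimp only at ho1 ho2
        rw [if_neg ho1, if_neg ho2, sub_zero, inner_zero_right, mul_zero]
      · simp only [not_or] at htouch
        obtain ⟨hb1p, hb1x, hb2p, hb2x⟩ := htouch
        show cb (b₁, b₂) * ⟪f b₂ - f b₁, _⟫_ℝ = 0
        rw [hf0 b₂ hb2x hb2p, hf0 b₁ hb1x hb1p, sub_zero, inner_zero_left, mul_zero]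
  -- the criterion gives (Q′Δλ)(c) = κ Σ_{x∈B(c)} (Δλ)(x) = 0
  have h1 := congrArg (fun φ : PiLp 2 (fun _ : Y => V) => φ c) (hcrit f hqf)
  simp only [PiLp.zero_apply] at h1
  rw [qL_apply] at h1
  unfold avgQ at h1
  rw [Finset.sum_congr rfl fun x hx => by rw [hP x hx, hwc x hx, LinearMap.id_apply], ← Finset.smul_sum,
    smul_eq_zero] at h1
  rcases h1 with h1 | h1
  · exact hκ h1
  · have h2 := hsum v
    rw [show (∑ x ∈ B c, WithLp.ofLp (lapL T bonds cb f) x) = ∑ x ∈ B c, lapL T bonds cb f x from rfl] at h1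
    rw [h1, inner_zero_left, ← real_inner_smul_right, ← real_inner_smul_right, ← inner_sub_right, ← hu, eq_comm,
      inner_self_eq_zero] at h2
    exact hv h2

end TwoBlock

end Literature.MathematicalPhysics.QuantumFieldTheory.Balaban1983to89.B8Eq194CriterionTwoBlockDefect
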